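import Summits.AnomalousDissipation.AnomalousDissipation.Theorems.DopplerClockCruxesGiveTarget
import Summits.AnomalousDissipation.AnomalousDissipation.Theorems.DopplerClockQuadratureStressFloorLaminarCalibration
import Summits.AnomalousDissipation.AnomalousDissipation.Theorems.DopplerClockForceAdmissible
import Summits.AnomalousDissipation.AnomalousDissipation.Theorems.DopplerClockDopplerWorkIdentity
import Literature.Analysis.FluidPDE.TorusClassicalLerayHopfProofs
import Literature.Analysis.FluidPDE.DoeringFoiasPowerProofs
import Literature.Analysis.FluidPDE.DoeringFoiasProofs
import HarnessLib

/-!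
# Strategy census r1 (REDIRECT strategist, second opinion) — typed part —
# crux `DopplerClock.InjectionControlsEnergy` (stmt-AnomalousDissipation-18130)

Companion of `STRATEGY-CENSUS-R1.md` (same crux directory). Everything here is sorry-free and is
stated against the ROUTE DECLS BY NAME (`Theses.DopplerClock.InjectionControlsEnergy`,
`QuadratureStressFloor`, `DopplerWorkIdentity`, `ForceAdmissible`, `DopplerZerothLaw`) and the
tree theorems landed for the route up to 2026-08-17T15:15Z. It is a crux WORKFILE (class
`cruxes-workfile`): nothing here closes or supports an item. What it adds to the first census
(`StrategyCensus.lean`, unit `cstrat-…-b1`):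

* §2 `boundedFamilyDoppler_holds` — the ∃-SHADOW OF C2 IS A THEOREM. The first census pinned C2 from
  below by the ∃-form `BoundedFamilyDoppler` ("a ν_j → 0 family of pinned Leray–Hopf flows of the
  swept pair with j-uniform mean energy", printed open for generic forces). For THIS design it is
  PROVED: the inertia-limited laminar streak arrays `u_L(ν_j)` (`dopplerClock_laminarStreaks_proof`,
  item 18132; global Leray–Hopf by `Torus.IsClassicalNSSolutionOn.isGlobalLerayHopf`; calibrated by
  the lead's `stub_laminarCalibration`) are pinned and have `⟨‖u_L‖²⟩ ≤ V² + F²/(4V²(2πn)²)`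
  uniformly in ν. Hence C2 has NO existential residue: its entire content is the universal quantifier
  over ALL pinned Leray–Hopf flows (`crux_iff_ceiling`, §1, recalled from the first census).
* §3 `not_universalKolmogorovFloor`, `not_universalDissipationFloor` — the only printed engine for a
  ν-uniform energy ceiling over all flows (a universal dissipation floor `ε ≥ β₀U³/ℓ`, whence
  `U² ≤ ‖f‖ℓ/β₀`; Doering–Foias 2002 §2, Frisch 1995 Ch. 5) DOES imply C2 (`crux_of_kolmogorovFloor`)
  but is FALSE on this class: the same laminar family is quiet, `meanDissipation = O(ν)` at
  `meanEnergy ≥ V²`. So T1(a) has no true dominating hypothesis, and no dissipation-side route to C2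
  exists.
* §4 `crux_iff_highEnergyFloor` — C2 ⟺ "every pinned flow of mean energy ≥ E₀ obeys a Kolmogorov
  floor `β₀ E^{3/2} ≤ ε`": the crux is EXACTLY a universal (all-flows) zeroth law on the high-energy
  sector of the class — the ∀-form of the law whose ∃-form (for some force) is the summit. It does not
  imply the summit (it is vacuous iff C2's ceiling holds), so T1 cannot certify `C2 ≥ S`; it is an
  independent universal open statement (census-capped).
* §5 loud/quiet split typed with glue PROVED (`crux_of_loudQuiet`) and both leaves shown to be implied
  by C2 (`C2 ⟺ NoQuietHoarding ∧ UniformInjectionCeiling`): each leaf is again a ν-uniform universal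
  bound — no honest decomposition.
* §6 THE RETARGET, typed and certified: in the landed glue `dopplerClockCruxesGiveTarget_proof` C2 is
  applied ONLY to the members of C1's family and ONLY to produce the target clause
  `∃ E, ∀ j, meanEnergy (u j) ≤ E`. `QuadratureStressFloorE` = C1 with that clause folded in;
  `target_of_stressFloorE : QuadratureStressFloorE → DopplerWorkIdentity → DopplerZerothLaw` and
  `summit_of_stressFloorE : QuadratureStressFloorE → DopplerWorkIdentity → ForceAdmissible →
  AnomalousDissipation` are PROVED (so a `closes` without C2 certifies), `C1 → C2 → C1E`
  (`stressFloorE_of_cruxes`) shows the retarget weakens the pair, and with the two closed supports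
  discharged `summit_of_stressFloorE'` displays the retargeted route as the single statement
  `C1E → S`.
-/

noncomputable section

-- `Summit.<Summit>.<Problem>` is the tree's mandated summit-side namespace (CONVENTIONS §2).
set_option linter.dupNamespace false

open MeasureTheory Set Filter Topology UnitAddTorus
open scoped InnerProductSpace RealInnerProductSpace

namespace Summit.AnomalousDissipation.AnomalousDissipation.Cruxes.InjectionControlsEnergy.StrategistCensusR1

open Literature.Analysis.FluidPDE Literature.Analysis.FluidPDE.Torus
open Literature.Analysis.FunctionSpaces Literature.Analysis.FunctionSpaces.Torus
open Summit.AnomalousDissipation.AnomalousDissipation.Theses.DopplerClock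
open Summit.AnomalousDissipation.AnomalousDissipation.Theorems

/-- The flat three-torus (local notation). -/
local notation "𝕋³" => UnitAddTorus (Fin 3)
/-- Velocity values (local notation). -/
local notation "E³" => EuclideanSpace ℝ (Fin 3)

/-! ### §0 The objects of the crux, by name -/

/-- The swept Doppler pair `f(x) = F sin(2πm x₁) cos(2πn x₂) e₀`, verbatim the route's expression. -/
abbrev dopplerForce (F : ℝ) (m n : ℕ) : 𝕋³ → E³ := fun x =>
  (F * (mFourier (Pi.single (1 : Fin 3) (m : ℤ)) x).im *
    (mFourier (Pi.single (2 : Fin 3) (n : ℤ)) x).re) • EuclideanSpace.single (0 : Fin 3) (1 : ℝ)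

/-- The pinned momentum `V e₂`. -/
abbrev drift (V : ℝ) : E³ := V • EuclideanSpace.single (2 : Fin 3) (1 : ℝ)

/-- The `limsup`-mean injection `W = ⟨(f,u)⟩⁺`, verbatim the route's expression. -/
abbrev injection (F : ℝ) (m n : ℕ) (u : ℝ → 𝕋³ → E³) : ℝ :=
  longTimeAvgSup fun t => ∫ x, ⟪dopplerForce F m n x, u t x⟫

/-- The laminar streak profile `w_L = sin(2πm x₁)(a cos 2πn x₂ + b sin 2πn x₂)`, `a = Fνκ²/D`,
`b = FV(2πn)/D`, `D = V²(2πn)² + ν²κ⁴`, verbatim the route's `LaminarStreaks` expression. -/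
abbrev laminarProfile (F V ν : ℝ) (m n : ℕ) (x : 𝕋³) : ℝ :=
  (mFourier (Pi.single (1 : Fin 3) (m : ℤ)) x).im *
    ((F * ν * ((2 * Real.pi) ^ 2 * ((m : ℝ) ^ 2 + (n : ℝ) ^ 2)) /
        (V ^ 2 * (2 * Real.pi * n) ^ 2 +
          ν ^ 2 * ((2 * Real.pi) ^ 2 * ((m : ℝ) ^ 2 + (n : ℝ) ^ 2)) ^ 2)) *
        (mFourier (Pi.single (2 : Fin 3) (n : ℤ)) x).re +
      (F * V * (2 * Real.pi * n) /
        (V ^ 2 * (2 * Real.pi * n) ^ 2 +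
          ν ^ 2 * ((2 * Real.pi) ^ 2 * ((m : ℝ) ^ 2 + (n : ℝ) ^ 2)) ^ 2)) *
        (mFourier (Pi.single (2 : Fin 3) (n : ℤ)) x).im)

/-- The laminar streak array `u_L(ν) = V e₂ + w_L e₀` (item `LaminarStreaks`, stmt-18132). -/
abbrev laminar (F V ν : ℝ) (m n : ℕ) : 𝕋³ → E³ := fun x =>
  V • EuclideanSpace.single (2 : Fin 3) (1 : ℝ) +
    laminarProfile F V ν m n x • EuclideanSpace.single (0 : Fin 3) (1 : ℝ)

/-- Sanity: the crux BY NAME is the abbreviated statement, by `Iff.rfl`. -/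
theorem crux_iff :
    InjectionControlsEnergy ↔
      ∀ (F V : ℝ) (m n : ℕ), 0 < F → 0 < V → 0 < m → 0 < n → ∃ C : ℝ,
        ∀ (ν : ℝ) (u₀ : 𝕋³ → E³) (u : ℝ → 𝕋³ → E³), 0 < ν →
          IsGlobalLerayHopf ν (fun _ => dopplerForce F m n) u₀ u → (∫ x, u₀ x = drift V) →
            meanEnergy u ≤ C * (1 + injection F m n u) :=
  Iff.rfl

/-- Smoothness of the swept pair (`Theorems.dopplerForce_isSmooth`, item 18131). -/
theorem dopplerForce_isSmooth' (F : ℝ) (m n : ℕ) : IsSmooth (dopplerForce F m n) :=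
  dopplerForce_isSmooth F _ _

/-- Zero mean of the swept pair (`Theorems.dopplerForce_hasZeroMean`, item 18131). -/
theorem dopplerForce_hasZeroMean' (F : ℝ) (m n : ℕ) : HasZeroMean (dopplerForce F m n) :=
  dopplerForce_hasZeroMean F _ _

/-! ### §1 Recalled from the first census: `W ≥ 0`, `W ≤ ‖f‖₂√E`, C2 ⟺ absolute ceiling -/

section Injection

variable {F : ℝ} {m n : ℕ} {ν : ℝ} {u₀ : 𝕋³ → E³} {u : ℝ → 𝕋³ → E³}

/-- **Mean injection is non-negative** along every global Leray–Hopf solution of the swept pair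
(first census, `injection_nonneg`; energy inequality from `0` + bounded Cesàro means). [folklore] -/
theorem injection_nonneg (hν : 0 < ν) (hu : IsGlobalLerayHopf ν (fun _ => dopplerForce F m n) u₀ u) :
    0 ≤ injection F m n u := by
  have hf := dopplerForce_isSmooth' F m n
  have hf0 := dopplerForce_hasZeroMean' F m n
  set P : ℝ → ℝ := fun t => ∫ x, ⟪dopplerForce F m n x, u t x⟫ with hPdef
  set E : ℝ → ℝ := fun t => ∫ x, ‖u t x‖ ^ 2 with hEdef
  set A : ℝ := Real.sqrt (∫ x, ‖dopplerForce F m n x‖ ^ 2) with hA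
  set K : ℝ := kineticEnergy u₀ / (2 * Real.pi ^ 2 * ν) +
    (2 * ‖∫ x, u 1 x‖ ^ 2 + (∫ x, ‖dopplerForce F m n x‖ ^ 2) / (16 * Real.pi ^ 4 * ν ^ 2)) with hK
  have hA0 : 0 ≤ A := Real.sqrt_nonneg _
  have hbdd : IsBoundedUnder (· ≤ ·) atTop (timeMean P) := by
    refine isBoundedUnder_of_eventually_le (a := A * Real.sqrt K) ?_
    filter_upwards [eventually_ge_atTop (1 : ℝ)] with T hT
    have hT0 : 0 < T := by linarith
    have h1 : |timeMean P T| ≤ A * Real.sqrt (timeMean E T) := hu.abs_timeMean_power_le hf hT0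
    have h2 : timeMean E T ≤ K := hu.timeMean_norm_sq_le hν hf hf0 hT
    exact (le_abs_self _).trans (h1.trans (mul_le_mul_of_nonneg_left (Real.sqrt_le_sqrt h2) hA0))
  show 0 ≤ limsup (timeMean P) atTop
  refine le_of_forall_pos_le_add fun ε hε => ?_
  have hE0 : 0 ≤ kineticEnergy u₀ := kineticEnergy_nonneg _
  have hev : ∀ᶠ T in atTop, -ε ≤ timeMean P T := by
    filter_upwards [eventually_gt_atTop 0, eventually_ge_atTop (kineticEnergy u₀ / ε)] with T hT hTε
    refine le_trans ?_ (impulseGrid_timeMean_injection_ge hν.le hu hT)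
    have h1 : kineticEnergy u₀ ≤ ε * T := by
      have := (div_le_iff₀ hε).1 hTε
      linarith [this]
    have h2 : kineticEnergy u₀ * T⁻¹ ≤ ε := by
      rw [← div_eq_mul_inv, div_le_iff₀ hT]
      exact h1
    linarith
  have h := le_limsup_of_frequently_le hev.frequently hbdd
  linarith

/-- **Mean injection is at most `‖f‖₂ √⟨‖u‖²⟩`** (`Torus.IsGlobalLerayHopf.meanPower_le`;
Cheskidov–Doering–Petrov 2007 eq. (17); Doering–Foias 2002 §2). -/
theorem injection_le (hν : 0 < ν) (hu : IsGlobalLerayHopf ν (fun _ => dopplerForce F m n) u₀ u) :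
    injection F m n u ≤ Real.sqrt (∫ x, ‖dopplerForce F m n x‖ ^ 2) * Real.sqrt (meanEnergy u) := by
  have h := hu.meanPower_le hν (dopplerForce_isSmooth' F m n) (dopplerForce_hasZeroMean' F m n)
  rw [rmsVelocity_eq_sqrt_meanEnergy] at h
  exact h

/-- **No leakage upward is automatic: `ε ≤ W`** (`DoeringFoias2002_dissipation_le_power_holds`, the
Leray–Hopf energy inequality in the mean; Doering–Foias 2002 §2). -/
theorem meanDissipation_le_injection (hν : 0 < ν)
    (hu : IsGlobalLerayHopf ν (fun _ => dopplerForce F m n) u₀ u) :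
    meanDissipation ν u ≤ injection F m n u :=
  DoeringFoias2002_dissipation_le_power_holds hν ((dopplerForce_isSmooth' F m n).memLp 2)
    (dopplerForce_hasZeroMean' F m n) u₀ u hu

end Injection

/-- **ν-uniform absolute energy ceiling** for the pinned Leray–Hopf class of the swept pair. -/
def UniformEnergyCeiling : Prop :=
  ∀ (F V : ℝ) (m n : ℕ), 0 < F → 0 < V → 0 < m → 0 < n → ∃ E : ℝ,
    ∀ (ν : ℝ) (u₀ : 𝕋³ → E³) (u : ℝ → 𝕋³ → E³), 0 < ν →
      IsGlobalLerayHopf ν (fun _ => dopplerForce F m n) u₀ u → (∫ x, u₀ x = drift V) →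
        meanEnergy u ≤ E

/-- C2 from the absolute ceiling (`C := max E 0`, uses `injection_nonneg`). -/
theorem crux_of_ceiling (h : UniformEnergyCeiling) : InjectionControlsEnergy := by
  intro F V m n hF hV hm hn
  obtain ⟨E, hE⟩ := h F V m n hF hV hm hn
  refine ⟨max E 0, fun ν u₀ u hν hu hmom => ?_⟩
  have h1 : meanEnergy u ≤ max E 0 := (hE ν u₀ u hν hu hmom).trans (le_max_left _ _)
  have hW : 0 ≤ injection F m n u := injection_nonneg hν hu
  have h0 : 0 ≤ max E 0 := le_max_right _ _
  have h2 : max E 0 ≤ max E 0 * (1 + injection F m n u) := by nlinarith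
  exact h1.trans h2

/-- The absolute ceiling from C2 (`E := 2C⁺ + (C⁺‖f‖₂)²`, uses `injection_le`). -/
theorem ceiling_of_crux (h : InjectionControlsEnergy) : UniformEnergyCeiling := by
  intro F V m n hF hV hm hn
  obtain ⟨C, hC⟩ := h F V m n hF hV hm hn
  refine ⟨2 * max C 0 + (max C 0 * Real.sqrt (∫ x, ‖dopplerForce F m n x‖ ^ 2)) ^ 2,
    fun ν u₀ u hν hu hmom => ?_⟩
  set A : ℝ := Real.sqrt (∫ x, ‖dopplerForce F m n x‖ ^ 2) with hA
  have hE : meanEnergy u ≤ C * (1 + injection F m n u) := hC ν u₀ u hν hu hmom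
  have hWle : injection F m n u ≤ A * Real.sqrt (meanEnergy u) := injection_le hν hu
  have hW0 : 0 ≤ injection F m n u := injection_nonneg hν hu
  have hE0 : 0 ≤ meanEnergy u := meanEnergy_nonneg u
  have hA0 : 0 ≤ A := Real.sqrt_nonneg _
  have hCp0 : 0 ≤ max C 0 := le_max_right _ _
  have hCle : C ≤ max C 0 := le_max_left _ _
  have h1 : meanEnergy u ≤ max C 0 * (1 + injection F m n u) :=
    hE.trans (mul_le_mul_of_nonneg_right hCle (by linarith))
  have hs0 : 0 ≤ Real.sqrt (meanEnergy u) := Real.sqrt_nonneg _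
  have hss : Real.sqrt (meanEnergy u) ^ 2 = meanEnergy u := Real.sq_sqrt hE0
  have h2 : meanEnergy u ≤ max C 0 + max C 0 * A * Real.sqrt (meanEnergy u) := by
    have h3 : max C 0 * injection F m n u ≤ max C 0 * (A * Real.sqrt (meanEnergy u)) :=
      mul_le_mul_of_nonneg_left hWle hCp0
    nlinarith [h1, h3]
  nlinarith [h2, hss, hs0, mul_nonneg hCp0 hA0, sq_nonneg (max C 0 * A - Real.sqrt (meanEnergy u))]

/-- **C2 is EXACTLY a ν-uniform absolute energy ceiling** (first census §1, now against the decl). -/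
theorem crux_iff_ceiling : InjectionControlsEnergy ↔ UniformEnergyCeiling :=
  ⟨ceiling_of_crux, crux_of_ceiling⟩

/-! ### §2 NEW: the ∃-shadow of C2 is a theorem (the laminar family) -/

section Laminar

variable {F V ν : ℝ} {m n : ℕ}

/-- The laminar streak array is a global classical steady solution (item `LaminarStreaks`). -/
theorem laminar_classical (hV : 0 < V) (hν : 0 < ν) (hn : 0 < n) :
    IsClassicalNSSolutionOn univ ν (fun _ => dopplerForce F m n) (fun _ => laminar F V ν m n)
      (fun _ _ => 0) :=
  (dopplerClock_laminarStreaks_proof F V ν m n hV hν hn).1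

/-- … hence a GLOBAL LERAY–HOPF solution from itself (Robinson–Rodrigo–Sadowski 2016 Thm. 6.5,
`Torus.IsClassicalNSSolutionOn.isGlobalLerayHopf`). -/
theorem laminar_isGlobalLerayHopf (hV : 0 < V) (hν : 0 < ν) (hn : 0 < n) :
    IsGlobalLerayHopf ν (fun _ => dopplerForce F m n) (laminar F V ν m n)
      (fun _ => laminar F V ν m n) :=
  (laminar_classical hV hν hn).isGlobalLerayHopf

/-- … with pinned momentum `V e₂` (item `LaminarStreaks`). -/
theorem integral_laminar (hV : 0 < V) (hν : 0 < ν) (hn : 0 < n) :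
    ∫ x, laminar F V ν m n x = drift V :=
  (dopplerClock_laminarStreaks_proof F V ν m n hV hν hn).2.1

/-- … calibrated (the lead's `stub_laminarCalibration`): `ε_L ≤ νκ²F²/(4V²(2πn)²)` and
`⟨‖u_L‖²⟩ ≤ V² + F²/(4V²(2πn)²)`, UNIFORMLY IN ν. -/
theorem laminar_calibration (hV : 0 < V) (hν : 0 < ν) (hn : 0 < n) :
    meanDissipation ν (fun _ : ℝ => laminar F V ν m n) ≤
        ν * ((2 * Real.pi) ^ 2 * ((m : ℝ) ^ 2 + (n : ℝ) ^ 2)) * F ^ 2 /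
          (4 * (V ^ 2 * (2 * Real.pi * n) ^ 2)) ∧
      meanEnergy (fun _ : ℝ => laminar F V ν m n) ≤ V ^ 2 + F ^ 2 / (4 * V ^ 2 * (2 * Real.pi * n) ^ 2) :=
  stub_laminarCalibration F V ν m n _ hV hν hn rfl

/-- … and never below the drift energy: `V² ≤ ⟨‖u_L‖²⟩` (`‖V e₂ + w e₀‖² = V² + w²`). -/
theorem sq_le_meanEnergy_laminar (hV : 0 < V) (hν : 0 < ν) (hn : 0 < n) :
    V ^ 2 ≤ meanEnergy (fun _ : ℝ => laminar F V ν m n) := by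
  rw [LaminarCalibration.meanEnergy_steady]
  have hcont : Continuous (laminar F V ν m n) :=
    ((laminar_classical (F := F) (m := m) hV hν hn).smooth_velocity.isSmooth_slice
      (mem_univ (0 : ℝ))).continuous
  have hint : Integrable (fun x => ‖laminar F V ν m n x‖ ^ 2) (volume : Measure 𝕋³) :=
    (hcont.norm.pow 2).integrable_unitAddTorus
  have hpt : ∀ x, V ^ 2 ≤ ‖laminar F V ν m n x‖ ^ 2 := fun x => by
    have h : ‖laminar F V ν m n x‖ ^ 2 = V ^ 2 + (laminarProfile F V ν m n x) ^ 2 :=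
      DopplerStreaks.norm_sq_drift_add V _
    rw [h]
    nlinarith [sq_nonneg (laminarProfile F V ν m n x)]
  have h1 : ∫ _x : 𝕋³, V ^ 2 = V ^ 2 := by simp
  calc V ^ 2 = ∫ _x : 𝕋³, V ^ 2 := h1.symm
    _ ≤ ∫ x, ‖laminar F V ν m n x‖ ^ 2 := integral_mono (integrable_const _) hint fun x => hpt x

end Laminar

/-- **The ∃-form** (first census §2; Doppler twin of `GPMeanBoundedFamily` stmt-15509 /
`Correlation.BoundedEnergyFamilyZM` stmt-14641 / ImpulseGrid's `UEDF`): for every design there are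
`ν_j → 0⁺`, pinned data and global Leray–Hopf flows of the swept pair with `j`-uniformly bounded
mean energy. -/
def BoundedFamilyDoppler : Prop :=
  ∀ (F V : ℝ) (m n : ℕ), 0 < F → 0 < V → 0 < m → 0 < n → ∃ E : ℝ,
    ∃ (ν : ℕ → ℝ) (u₀ : ℕ → 𝕋³ → E³) (u : ℕ → ℝ → 𝕋³ → E³),
      (∀ j, 0 < ν j) ∧ Tendsto ν atTop (𝓝 0) ∧
      (∀ j, IsGlobalLerayHopf (ν j) (fun _ => dopplerForce F m n) (u₀ j) (u j)) ∧
      (∀ j, ∫ x, u₀ j x = drift V) ∧ ∀ j, meanEnergy (u j) ≤ E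

/-- **NEW — the ∃-shadow of C2 is a THEOREM for this design**: the laminar streak arrays at
`ν_j = 1/(j+1)` are a pinned global Leray–Hopf family with mean energy `≤ V² + F²/(4V²(2πn)²)`.
(So the first census's "lower pin, printed open" is settled here; C2's whole content is the `∀`.) -/
theorem boundedFamilyDoppler_holds : BoundedFamilyDoppler := by
  intro F V m n _hF hV _hm hn
  have hνpos : ∀ j : ℕ, (0 : ℝ) < 1 / ((j : ℝ) + 1) := fun j => by positivity
  exact ⟨V ^ 2 + F ^ 2 / (4 * V ^ 2 * (2 * Real.pi * n) ^ 2), fun j => 1 / ((j : ℝ) + 1),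
    fun j => laminar F V (1 / ((j : ℝ) + 1)) m n, fun j _ => laminar F V (1 / ((j : ℝ) + 1)) m n,
    hνpos, tendsto_one_div_add_atTop_nhds_zero_nat,
    fun j => laminar_isGlobalLerayHopf hV (hνpos j) hn, fun j => integral_laminar hV (hνpos j) hn,
    fun j => (laminar_calibration (F := F) (m := m) hV (hνpos j) hn).2⟩

/-- Converse bookkeeping (first census): C2 ⇒ the ∃-form — now moot, both sides being known. -/
theorem boundedFamily_of_crux (_h : InjectionControlsEnergy) : BoundedFamilyDoppler :=
  boundedFamilyDoppler_holds

/-! ### §3 NEW: the universal dissipation / Kolmogorov floor implies C2 but is FALSE here -/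

/-- **H_K41 — universal Kolmogorov floor** on the pinned class: `β₀ E √E ≤ ε` for ALL pinned
Leray–Hopf flows, `β₀ = β₀(design) > 0` (the ∀-form of `ε = βU³/ℓ`, `β ≥ β₀`; Doering–Foias 2002
§2, Frisch 1995 Ch. 5). The candidate dominating hypothesis of T1(a). -/
def UniversalKolmogorovFloor : Prop :=
  ∀ (F V : ℝ) (m n : ℕ), 0 < F → 0 < V → 0 < m → 0 < n → ∃ β₀ : ℝ, 0 < β₀ ∧
    ∀ (ν : ℝ) (u₀ : 𝕋³ → E³) (u : ℝ → 𝕋³ → E³), 0 < ν →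
      IsGlobalLerayHopf ν (fun _ => dopplerForce F m n) u₀ u → (∫ x, u₀ x = drift V) →
        β₀ * meanEnergy u * Real.sqrt (meanEnergy u) ≤ meanDissipation ν u

/-- **H_ε — universal dissipation floor at small ν** (weaker: a constant floor, only for `ν ≤ ν₀`). -/
def UniversalDissipationFloor : Prop :=
  ∀ (F V : ℝ) (m n : ℕ), 0 < F → 0 < V → 0 < m → 0 < n → ∃ ε₀ : ℝ, 0 < ε₀ ∧ ∃ ν₀ : ℝ, 0 < ν₀ ∧
    ∀ (ν : ℝ) (u₀ : 𝕋³ → E³) (u : ℝ → 𝕋³ → E³), 0 < ν → ν ≤ ν₀ →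
      IsGlobalLerayHopf ν (fun _ => dopplerForce F m n) u₀ u → (∫ x, u₀ x = drift V) →
        ε₀ ≤ meanDissipation ν u

/-- The elementary step `β₀ E √E ≤ A √E ⇒ E ≤ A/β₀` (`E ≥ 0`, `A ≥ 0`, `β₀ > 0`). [folklore] -/
theorem le_div_of_floor {β₀ A E : ℝ} (hβ : 0 < β₀) (hA : 0 ≤ A) (hE : 0 ≤ E)
    (h : β₀ * E * Real.sqrt E ≤ A * Real.sqrt E) : E ≤ A / β₀ := by
  rcases (Real.sqrt_nonneg E).eq_or_lt with hs | hs
  · have hE0 : E = 0 := by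
      have := Real.sqrt_eq_zero'.1 hs.symm
      linarith
    rw [hE0]
    positivity
  · rw [le_div_iff₀ hβ]
    have h' : β₀ * E ≤ A := le_of_mul_le_mul_right (by linarith [h]) hs
    linarith

/-- **H_K41 ⇒ C2** (`ε ≤ W ≤ ‖f‖₂√E`, so `β₀E√E ≤ ‖f‖₂√E` and `E ≤ ‖f‖₂/β₀`): the universal floor
IS a dominating hypothesis in the sense of T1(a) … -/
theorem crux_of_kolmogorovFloor (h : UniversalKolmogorovFloor) : InjectionControlsEnergy := by
  refine crux_of_ceiling fun F V m n hF hV hm hn => ?_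
  obtain ⟨β₀, hβ₀, hfl⟩ := h F V m n hF hV hm hn
  refine ⟨Real.sqrt (∫ x, ‖dopplerForce F m n x‖ ^ 2) / β₀, fun ν u₀ u hν hu hmom => ?_⟩
  have h1 := hfl ν u₀ u hν hu hmom
  have h2 := (meanDissipation_le_injection hν hu).trans (injection_le hν hu)
  exact le_div_of_floor hβ₀ (Real.sqrt_nonneg _) (meanEnergy_nonneg u) (h1.trans h2)

/-- **… but it is FALSE on this class, for EVERY design and EVERY `β₀ > 0`**: the laminar streak
array at a small viscosity is a pinned global Leray–Hopf flow with `ε_L ≤ νκ²F²/(4V²(2πn)²) < β₀V³ ≤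
β₀ E_L √E_L`. -/
theorem kolmogorovFloor_fails (F : ℝ) {V : ℝ} (m : ℕ) {n : ℕ} (hV : 0 < V) (hn : 0 < n)
    {β₀ : ℝ} (hβ₀ : 0 < β₀) :
    ∃ (ν : ℝ) (u₀ : 𝕋³ → E³) (u : ℝ → 𝕋³ → E³), 0 < ν ∧
      IsGlobalLerayHopf ν (fun _ => dopplerForce F m n) u₀ u ∧ (∫ x, u₀ x = drift V) ∧
        meanDissipation ν u < β₀ * meanEnergy u * Real.sqrt (meanEnergy u) := by
  set B : ℝ := ((2 * Real.pi) ^ 2 * ((m : ℝ) ^ 2 + (n : ℝ) ^ 2)) * F ^ 2 /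
    (4 * (V ^ 2 * (2 * Real.pi * n) ^ 2)) with hB
  have hB0 : 0 ≤ B := by positivity
  set ν : ℝ := β₀ * V ^ 3 / (2 * (B + 1)) with hνdef
  have hν : 0 < ν := by positivity
  refine ⟨ν, laminar F V ν m n, fun _ => laminar F V ν m n, hν, laminar_isGlobalLerayHopf hV hν hn,
    integral_laminar hV hν hn, ?_⟩
  have hd := (laminar_calibration (F := F) (m := m) hV hν hn).1
  have hE := sq_le_meanEnergy_laminar (F := F) (m := m) hV hν hn
  set E := meanEnergy (fun _ : ℝ => laminar F V ν m n) with hEdef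
  -- `ε_L ≤ ν B < β₀ V³`
  have hd' : meanDissipation ν (fun _ : ℝ => laminar F V ν m n) ≤ ν * B := by
    have : ν * ((2 * Real.pi) ^ 2 * ((m : ℝ) ^ 2 + (n : ℝ) ^ 2)) * F ^ 2 /
        (4 * (V ^ 2 * (2 * Real.pi * n) ^ 2)) = ν * B := by
      rw [hB]
      ring
    rw [← this]
    exact hd
  have hνB : ν * B < β₀ * V ^ 3 := by
    have h1 : ν * B ≤ ν * (B + 1) := mul_le_mul_of_nonneg_left (by linarith) hν.le
    have h2 : ν * (B + 1) = β₀ * V ^ 3 / 2 := by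
      rw [hνdef]
      field_simp
    have h3 : 0 < β₀ * V ^ 3 := by positivity
    linarith
  -- `β₀ V³ ≤ β₀ E √E`
  have hsq : V ≤ Real.sqrt E := Real.le_sqrt_of_sq_le hE
  have hV3 : β₀ * V ^ 3 ≤ β₀ * E * Real.sqrt E := by
    have h1 : V ^ 3 = V ^ 2 * V := by ring
    rw [mul_assoc, h1]
    exact mul_le_mul_of_nonneg_left
      (mul_le_mul hE hsq hV.le ((sq_nonneg V).trans hE)) hβ₀.le
  linarith

/-- **¬ H_K41.** -/
theorem not_universalKolmogorovFloor : ¬ UniversalKolmogorovFloor := by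
  intro h
  obtain ⟨β₀, hβ₀, hfl⟩ := h 1 1 1 1 one_pos one_pos one_pos one_pos
  obtain ⟨ν, u₀, u, hν, hu, hmom, hlt⟩ := kolmogorovFloor_fails (1 : ℝ) 1 one_pos one_pos hβ₀
  exact absurd (hfl ν u₀ u hν hu hmom) (not_le.2 hlt)

/-- **The class is arbitrarily QUIET at every small ν** (for every design): below any `ε₀ > 0`. -/
theorem dissipationFloor_fails (F : ℝ) {V : ℝ} (m : ℕ) {n : ℕ} (hV : 0 < V) (hn : 0 < n)
    {ε₀ : ℝ} (hε₀ : 0 < ε₀) {ν₀ : ℝ} (hν₀ : 0 < ν₀) :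
    ∃ (ν : ℝ) (u₀ : 𝕋³ → E³) (u : ℝ → 𝕋³ → E³), 0 < ν ∧ ν ≤ ν₀ ∧
      IsGlobalLerayHopf ν (fun _ => dopplerForce F m n) u₀ u ∧ (∫ x, u₀ x = drift V) ∧
        meanDissipation ν u < ε₀ := by
  set B : ℝ := ((2 * Real.pi) ^ 2 * ((m : ℝ) ^ 2 + (n : ℝ) ^ 2)) * F ^ 2 /
    (4 * (V ^ 2 * (2 * Real.pi * n) ^ 2)) with hB
  have hB0 : 0 ≤ B := by positivity
  set ν : ℝ := min ν₀ (ε₀ / (2 * (B + 1))) with hνdef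
  have hν : 0 < ν := lt_min hν₀ (by positivity)
  refine ⟨ν, laminar F V ν m n, fun _ => laminar F V ν m n, hν, min_le_left _ _,
    laminar_isGlobalLerayHopf hV hν hn, integral_laminar hV hν hn, ?_⟩
  have hd := (laminar_calibration (F := F) (m := m) hV hν hn).1
  have hd' : meanDissipation ν (fun _ : ℝ => laminar F V ν m n) ≤ ν * B := by
    have : ν * ((2 * Real.pi) ^ 2 * ((m : ℝ) ^ 2 + (n : ℝ) ^ 2)) * F ^ 2 /
        (4 * (V ^ 2 * (2 * Real.pi * n) ^ 2)) = ν * B := by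
      rw [hB]
      ring
    rw [← this]
    exact hd
  have hνle : ν ≤ ε₀ / (2 * (B + 1)) := min_le_right _ _
  have h1 : ν * B ≤ ν * (B + 1) := mul_le_mul_of_nonneg_left (by linarith) hν.le
  have h2 : ν * (B + 1) ≤ ε₀ / (2 * (B + 1)) * (B + 1) :=
    mul_le_mul_of_nonneg_right hνle (by linarith)
  have h3 : ε₀ / (2 * (B + 1)) * (B + 1) = ε₀ / 2 := by
    field_simp
  linarith

/-- **¬ H_ε.** -/
theorem not_universalDissipationFloor : ¬ UniversalDissipationFloor := by
  intro h
  obtain ⟨ε₀, hε₀, ν₀, hν₀, hfl⟩ := h 1 1 1 1 one_pos one_pos one_pos one_pos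
  obtain ⟨ν, u₀, u, hν, hνle, hu, hmom, hlt⟩ :=
    dissipationFloor_fails (1 : ℝ) 1 one_pos one_pos hε₀ hν₀
  exact absurd (hfl ν u₀ u hν hνle hu hmom) (not_le.2 hlt)

/-! ### §4 NEW: C2 ⟺ a universal zeroth law on the HIGH-ENERGY sector -/

/-- **HEKF — high-energy Kolmogorov floor**: every pinned Leray–Hopf flow whose mean energy reaches
`E₀` obeys `β₀ E √E ≤ ε` (`E₀, β₀` depending on the design only). A universal (∀-flows)
zeroth-law statement restricted to the high-energy sector; vacuous iff the sector is empty. -/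
def HighEnergyKolmogorovFloor : Prop :=
  ∀ (F V : ℝ) (m n : ℕ), 0 < F → 0 < V → 0 < m → 0 < n → ∃ E₀ β₀ : ℝ, 0 < β₀ ∧
    ∀ (ν : ℝ) (u₀ : 𝕋³ → E³) (u : ℝ → 𝕋³ → E³), 0 < ν →
      IsGlobalLerayHopf ν (fun _ => dopplerForce F m n) u₀ u → (∫ x, u₀ x = drift V) →
        E₀ ≤ meanEnergy u → β₀ * meanEnergy u * Real.sqrt (meanEnergy u) ≤ meanDissipation ν u

/-- C2 ⇒ HEKF (vacuously: `E₀ := E + 1` above the ceiling). -/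
theorem highEnergyFloor_of_crux (h : InjectionControlsEnergy) : HighEnergyKolmogorovFloor := by
  intro F V m n hF hV hm hn
  obtain ⟨E, hE⟩ := ceiling_of_crux h F V m n hF hV hm hn
  refine ⟨E + 1, 1, one_pos, fun ν u₀ u hν hu hmom hbig => ?_⟩
  have := hE ν u₀ u hν hu hmom
  linarith

/-- HEKF ⇒ C2 (`E ≤ max E₀ (‖f‖₂/β₀)`: below `E₀` trivially, above it by `ε ≤ W ≤ ‖f‖₂√E`). -/
theorem crux_of_highEnergyFloor (h : HighEnergyKolmogorovFloor) : InjectionControlsEnergy := by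
  refine crux_of_ceiling fun F V m n hF hV hm hn => ?_
  obtain ⟨E₀, β₀, hβ₀, hfl⟩ := h F V m n hF hV hm hn
  refine ⟨max E₀ (Real.sqrt (∫ x, ‖dopplerForce F m n x‖ ^ 2) / β₀), fun ν u₀ u hν hu hmom => ?_⟩
  by_cases hlt : meanEnergy u < E₀
  · exact hlt.le.trans (le_max_left _ _)
  · have h1 := hfl ν u₀ u hν hu hmom (not_lt.1 hlt)
    have h2 := (meanDissipation_le_injection hν hu).trans (injection_le hν hu)
    exact (le_div_of_floor hβ₀ (Real.sqrt_nonneg _) (meanEnergy_nonneg u) (h1.trans h2)).trans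
      (le_max_right _ _)

/-- **C2 ⟺ HEKF**: the crux is exactly the universal zeroth law on the high-energy sector of the
pinned class (the ∀-form, for this design, of the law whose ∃-form is the summit). -/
theorem crux_iff_highEnergyFloor : InjectionControlsEnergy ↔ HighEnergyKolmogorovFloor :=
  ⟨highEnergyFloor_of_crux, crux_of_highEnergyFloor⟩

/-! ### §5 NEW: the loud/quiet split, typed, glue proved — both leaves are C2-class -/

/-- **Leaf 1 — uniform injection ceiling**: `W ≤ W₀(design)` for all pinned flows, all ν. -/
def UniformInjectionCeiling : Prop :=
  ∀ (F V : ℝ) (m n : ℕ), 0 < F → 0 < V → 0 < m → 0 < n → ∃ W₀ : ℝ,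
    ∀ (ν : ℝ) (u₀ : 𝕋³ → E³) (u : ℝ → 𝕋³ → E³), 0 < ν →
      IsGlobalLerayHopf ν (fun _ => dopplerForce F m n) u₀ u → (∫ x, u₀ x = drift V) →
        injection F m n u ≤ W₀

/-- **Leaf 2 — no quiet hoarding**: flows of bounded injection have bounded energy (uniformly in ν):
the anti-condensate statement. -/
def NoQuietHoarding : Prop :=
  ∀ (F V : ℝ) (m n : ℕ), 0 < F → 0 < V → 0 < m → 0 < n → ∀ W₀ : ℝ, ∃ E₀ : ℝ,
    ∀ (ν : ℝ) (u₀ : 𝕋³ → E³) (u : ℝ → 𝕋³ → E³), 0 < ν →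
      IsGlobalLerayHopf ν (fun _ => dopplerForce F m n) u₀ u → (∫ x, u₀ x = drift V) →
        injection F m n u ≤ W₀ → meanEnergy u ≤ E₀

/-- **Glue, PROVED**: `NoQuietHoarding → UniformInjectionCeiling → C2`. -/
theorem crux_of_loudQuiet (hq : NoQuietHoarding) (hl : UniformInjectionCeiling) :
    InjectionControlsEnergy := by
  refine crux_of_ceiling fun F V m n hF hV hm hn => ?_
  obtain ⟨W₀, hW⟩ := hl F V m n hF hV hm hn
  obtain ⟨E₀, hE⟩ := hq F V m n hF hV hm hn W₀
  exact ⟨E₀, fun ν u₀ u hν hu hmom => hE ν u₀ u hν hu hmom (hW ν u₀ u hν hu hmom)⟩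

/-- … and conversely C2 gives leaf 1 (`W ≤ ‖f‖₂√E ≤ ‖f‖₂√E⁺`) … -/
theorem injectionCeiling_of_crux (h : InjectionControlsEnergy) : UniformInjectionCeiling := by
  intro F V m n hF hV hm hn
  obtain ⟨E, hE⟩ := ceiling_of_crux h F V m n hF hV hm hn
  refine ⟨Real.sqrt (∫ x, ‖dopplerForce F m n x‖ ^ 2) * Real.sqrt (max E 0),
    fun ν u₀ u hν hu hmom => (injection_le hν hu).trans ?_⟩
  exact mul_le_mul_of_nonneg_left
    (Real.sqrt_le_sqrt ((hE ν u₀ u hν hu hmom).trans (le_max_left _ _))) (Real.sqrt_nonneg _)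

/-- … and leaf 2 (trivially, the ceiling ignores `W₀`): so C2 ⟺ leaf 1 ∧ leaf 2 and the split
isolates nothing weaker than C2's own kernel (a ν-uniform universal bound). -/
theorem noQuietHoarding_of_crux (h : InjectionControlsEnergy) : NoQuietHoarding := by
  intro F V m n hF hV hm hn _W₀
  obtain ⟨E, hE⟩ := ceiling_of_crux h F V m n hF hV hm hn
  exact ⟨E, fun ν u₀ u hν hu hmom _ => hE ν u₀ u hν hu hmom⟩

theorem crux_iff_loudQuiet :
    InjectionControlsEnergy ↔ NoQuietHoarding ∧ UniformInjectionCeiling :=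
  ⟨fun h => ⟨noQuietHoarding_of_crux h, injectionCeiling_of_crux h⟩,
    fun h => crux_of_loudQuiet h.1 h.2⟩

/-! ### §6 NEW: the retarget — C2 is consumed only at C1's family; fold it in (typed + certified) -/

/-- **C1E — `QuadratureStressFloor` with the family-level energy clause folded in**: verbatim the
route's `QuadratureStressFloor` with the single extra conjunct `(∃ E, ∀ j, meanEnergy (u j) ≤ E)`
inserted before the stress floor. This is the only use the route makes of C2. -/
def QuadratureStressFloorE : Prop :=
  ∃ (F V : ℝ) (m n : ℕ), 0 < F ∧ 0 < V ∧ 0 < m ∧ 0 < n ∧ ∃ (Λ : Literature.Analysis.FluidPDE.GeneralizedLimit), ∃ (ν : ℕ → ℝ) (u₀ : ℕ → UnitAddTorus (Fin 3) → EuclideanSpace ℝ (Fin 3)) (u : ℕ → ℝ → UnitAddTorus (Fin 3) → EuclideanSpace ℝ (Fin 3)), (∀ j, 0 < ν j) ∧ Filter.Tendsto ν Filter.atTop (nhds 0) ∧ (∀ j, Literature.Analysis.FluidPDE.Torus.IsGlobalLerayHopf (ν j) (fun _ => (fun (x : UnitAddTorus (Fin 3)) => (F * (UnitAddTorus.mFourier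 (Pi.single (1 : Fin 3) (m : ℤ)) x).im * (UnitAddTorus.mFourier (Pi.single (2 : Fin 3) (n : ℤ)) x).re) • EuclideanSpace.single (0 : Fin 3) (1 : ℝ))) (u₀ j) (u j)) ∧ (∀ j, ∫ x, u₀ j x = V • EuclideanSpace.single (2 : Fin 3) (1 : ℝ)) ∧ (∀ j, ∃ C : ℝ, ∀ t : ℝ, 0 ≤ t → Literature.Analysis.FunctionSpaces.Torus.kineticEnergy (u j t) ≤ C) ∧ (∀ j, Literature.Analysis.FluidPDE.longTimeAvgSup (fun t => ∫ x, inner ℝ ((F * (UnitAddTorus.mFourier (Pi.single (1 : Fin 3) (m : ℤ)) x).im * (UnitAddTorus.mFourier (Pi.single (2 : Fin 3) (n : ℤ)) x).re) • EuclideanSpace.single (0 : Fin 3) (1 : ℝ)) (u j t x)) ≤ Literature.Analysis.FluidPDE.meanDissipation (ν j) (u j)) ∧ (∃ E : ℝ, ∀ j, Literature.Analysis.FluidPDE.meanEnergy (u j) ≤ E) ∧ ∃ ε₀ : ℝ, 0 < ε₀ ∧ ∀ j, ε₀ ≤ -Λ.longTimeAvg (fun t => ∫ x, inner ℝ (u j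 t x - V • EuclideanSpace.single (2 : Fin 3) (1 : ℝ)) (Literature.Analysis.FunctionSpaces.Torus.convect (fun y => u j t y - V • EuclideanSpace.single (2 : Fin 3) (1 : ℝ)) (fun (y : UnitAddTorus (Fin 3)) => ((UnitAddTorus.mFourier (Pi.single (1 : Fin 3) (m : ℤ)) y).im * (UnitAddTorus.mFourier (Pi.single (2 : Fin 3) (n : ℤ)) y).im) • EuclideanSpace.single (0 : Fin 3) (1 : ℝ)) x))

/-- C1E ⇒ C1 (drop the clause). -/
theorem stressFloor_of_stressFloorE (h : QuadratureStressFloorE) : QuadratureStressFloor := by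
  obtain ⟨F, V, m, n, hF, hV, hm, hn, Λ, ν, u₀, u, hν, hν0, hLH, hmom, hsup, hnoleak, -, ε₀, hε₀,
    hfloor⟩ := h
  exact ⟨F, V, m, n, hF, hV, hm, hn, Λ, ν, u₀, u, hν, hν0, hLH, hmom, hsup, hnoleak, ε₀, hε₀, hfloor⟩

/-- **C1 → C2 → C1E**: the retarget WEAKENS the pair of cruxes (C2 is applied to the family only,
exactly as in `dopplerClockCruxesGiveTarget_proof`). -/
theorem stressFloorE_of_cruxes (h₁ : QuadratureStressFloor) (h₂ : InjectionControlsEnergy) :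
    QuadratureStressFloorE := by
  obtain ⟨F, V, m, n, hF, hV, hm, hn, Λ, ν, u₀, u, hν, hν0, hLH, hmom, hsup, hnoleak, ε₀, hε₀,
    hfloor⟩ := h₁
  obtain ⟨Cc, hCc⟩ := h₂ F V m n hF hV hm hn
  have hfS : IsSmooth (fun (x : UnitAddTorus (Fin 3)) =>
      (F * (UnitAddTorus.mFourier (Pi.single (1 : Fin 3) (m : ℤ)) x).im *
        (UnitAddTorus.mFourier (Pi.single (2 : Fin 3) (n : ℤ)) x).re) •
        EuclideanSpace.single (0 : Fin 3) (1 : ℝ)) :=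
    dopplerClock_isSmooth_im_mul_re_smul F _ _ _
  have hE : ∀ j, meanEnergy (u j) ≤ 2 * max Cc 0 + (max Cc 0 * Real.sqrt (∫ x, ‖(fun (x : 𝕋³) =>
      (F * (UnitAddTorus.mFourier (Pi.single (1 : Fin 3) (m : ℤ)) x).im *
        (UnitAddTorus.mFourier (Pi.single (2 : Fin 3) (n : ℤ)) x).re) •
        EuclideanSpace.single (0 : Fin 3) (1 : ℝ)) x‖ ^ 2)) ^ 2 :=
    fun j => dopplerClock_meanEnergy_le_of_le_mul Λ (hν j).le hfS (hLH j) (hsup j)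
      (hCc (ν j) (u₀ j) (u j) (hν j) (hLH j) (hmom j))
  exact ⟨F, V, m, n, hF, hV, hm, hn, Λ, ν, u₀, u, hν, hν0, hLH, hmom, hsup, hnoleak, ⟨_, hE⟩, ε₀,
    hε₀, hfloor⟩

/-- **The retargeted glue, PROVED**: `C1E → DopplerWorkIdentity → DopplerZerothLaw` — the landed
`dopplerClockCruxesGiveTarget_proof` with its single C2 step replaced by the folded clause
(`dopplerClock_abs_longTimeAvg_inner_le`, `dopplerClock_tail_arith`, no leakage; Doering–Foias 2002
§2). -/
theorem target_of_stressFloorE (h₁ : QuadratureStressFloorE) (hI : DopplerWorkIdentity) :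
    DopplerZerothLaw := by
  obtain ⟨F, V, m, n, hF, hV, hm, hn, Λ, ν, u₀, u, hν, hν0, hLH, hmom, hsup, hnoleak, ⟨E, hE⟩, ε₀,
    hε₀, hfloor⟩ := h₁
  have hn' : (0 : ℝ) < (n : ℝ) := Nat.cast_pos.2 hn
  have hfS : IsSmooth (fun (x : UnitAddTorus (Fin 3)) =>
      (F * (UnitAddTorus.mFourier (Pi.single (1 : Fin 3) (m : ℤ)) x).im *
        (UnitAddTorus.mFourier (Pi.single (2 : Fin 3) (n : ℤ)) x).re) •
        EuclideanSpace.single (0 : Fin 3) (1 : ℝ)) :=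
    dopplerClock_isSmooth_im_mul_re_smul F _ _ _
  have hΨS : IsSmooth (fun (y : UnitAddTorus (Fin 3)) =>
      ((UnitAddTorus.mFourier (Pi.single (1 : Fin 3) (m : ℤ)) y).im *
        (UnitAddTorus.mFourier (Pi.single (2 : Fin 3) (n : ℤ)) y).im) •
        EuclideanSpace.single (0 : Fin 3) (1 : ℝ)) :=
    dopplerClock_isSmooth_im_mul_im_smul _ _ _
  -- uniform bound on the quadrature pairing `Λ⟨(Ψ_s, u_j)⟩` from the folded energy clause
  obtain ⟨K, hK0, hK⟩ := exists_nonneg_forall_norm_le_of_continuous hΨS.continuous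
  have hB : ∀ j, |Λ.longTimeAvg (fun t => ∫ x, ⟪((UnitAddTorus.mFourier
      (Pi.single (1 : Fin 3) (m : ℤ)) x).im * (UnitAddTorus.mFourier
      (Pi.single (2 : Fin 3) (n : ℤ)) x).im) • EuclideanSpace.single (0 : Fin 3) (1 : ℝ),
      u j t x⟫)| ≤ K * (2⁻¹ * (1 + (E + 1))) := by
    intro j
    obtain ⟨C, hC⟩ := hsup j
    exact dopplerClock_abs_longTimeAvg_inner_le Λ (hLH j) hΨS.continuous hK0 hK hC (hE j)
  have hM0 : 0 ≤ K * (2⁻¹ * (1 + (E + 1))) := (abs_nonneg _).trans (hB 0)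
  have hκ : (0 : ℝ) ≤ (2 * Real.pi) ^ 2 * ((m : ℝ) ^ 2 + (n : ℝ) ^ 2) := by positivity
  have hden : 0 < 2 * ((2 * Real.pi) ^ 2 * ((m : ℝ) ^ 2 + (n : ℝ) ^ 2) *
      (K * (2⁻¹ * (1 + (E + 1)))) + 1) := by positivity
  obtain ⟨J, hJ⟩ : ∃ J : ℕ, ∀ j ≥ J, ν j < ε₀ / (2 * ((2 * Real.pi) ^ 2 *
      ((m : ℝ) ^ 2 + (n : ℝ) ^ 2) * (K * (2⁻¹ * (1 + (E + 1)))) + 1)) :=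
    eventually_atTop.1 (hν0.eventually (gt_mem_nhds (div_pos hε₀ hden)))
  have hc : 0 < F / (V * (2 * Real.pi * n)) := by positivity
  have hfloorTail : ∀ j, J ≤ j →
      F / (V * (2 * Real.pi * n)) * (ε₀ / 2) ≤ meanDissipation (ν j) (u j) := by
    intro j hj
    obtain ⟨C, hC⟩ := hsup j
    have hid := hI Λ F V (ν j) m n (u₀ j) (u j) hV (hν j) hn (hLH j) (hmom j) ⟨C, hC⟩
    have hsmall : ν j * ((2 * Real.pi) ^ 2 * ((m : ℝ) ^ 2 + (n : ℝ) ^ 2) *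
        (K * (2⁻¹ * (1 + (E + 1)))) + 1) < ε₀ / 2 := by
      have h := (lt_div_iff₀ hden).1 (hJ j hj)
      linarith
    have hP := dopplerClock_tail_arith hc hid (hfloor j) (hB j) (hν j).le hκ hsmall
    exact hP.trans ((LoudWakes.longTimeAvg_inner_le_longTimeAvgSup Λ hfS.continuous (hLH j)
      ⟨C, hC⟩).trans (hnoleak j))
  exact ⟨F, V, m, n, hF, hV, hm, hn, fun j => ν (j + J), fun j => u₀ (j + J),
    fun j => u (j + J), fun j => hν _, hν0.comp (tendsto_add_atTop_nat J), fun j => hLH _,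
    fun j => hmom _, ⟨E, fun j => hE _⟩, F / (V * (2 * Real.pi * n)) * (ε₀ / 2), by positivity,
    fun j => hfloorTail (j + J) (Nat.le_add_left J j)⟩

/-- **The retargeted deciding theorem, certified shape** (what tenure's new `glue.lean` would be):
`C1E → DopplerWorkIdentity → ForceAdmissible → AnomalousDissipation`, three lines as the route's
current `closes`. -/
theorem summit_of_stressFloorE (h₁ : QuadratureStressFloorE) (hI : DopplerWorkIdentity)
    (hA : ForceAdmissible) : _root_.AnomalousDissipation := by
  obtain ⟨F, V, m, n, _hF, _hV, _hm, _hn, ν, u₀, u, hν, hν0, hLH, _hmom, hE, ε, hε, hεu⟩ :=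
    target_of_stressFloorE h₁ hI
  obtain ⟨hs, hd, hz⟩ := hA F m n
  exact ⟨_, hs, hd, hz, ν, u₀, u, hν, hν0, hLH, hE, ε, hε, hεu⟩

/-- … and with the two CLOSED supports discharged (`dopplerWorkIdentity_proof`, item 18133;
`dopplerClock_forceAdmissible_proof`, item 18131) the retargeted route is the single statement
`C1E → S`. -/
theorem summit_of_stressFloorE' (h : QuadratureStressFloorE) : _root_.AnomalousDissipation :=
  summit_of_stressFloorE h dopplerWorkIdentity_proof dopplerClock_forceAdmissible_proof

end Summit.AnomalousDissipation.AnomalousDissipation.Cruxes.InjectionControlsEnergy.StrategistCensusR1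

end
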